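import Mathlib.RepresentationTheory.Intertwining
import Mathlib.LinearAlgebra.Isomorphisms
import Mathlib.LinearAlgebra.Projection
import HarnessLib

/-!
# An endomorphism acting by different scalars on kernel and image splits an extension («SIGN-SPLIT»)

Generic linear algebra ∕ representation theory over a commutative ring `k` (any monoid `G`), Mathlib-only, THEOREMS ONLY
(no `def`, no named fact, no instance).

Let `p : M → A'` be a SURJECTIVE `k`-linear map — an extension `0 → ker p → M → A' → 0` — and `φ ∈ End_k(M)` with
`φ = a` on `ker p` and `p ∘ φ = b • p` (so `φ` induces the scalar `b` on the quotient `M ⧸ ker p ≅ A'`), where `b - a` is a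
UNIT of `k`.  Then:

* §1 (linear algebra) `(φ - a)(φ - b) = 0` on `M` and `ker (φ - a) = ker p`; the endomorphism `ψ := (b - a)⁻¹ • (φ - a)` kills
  `ker p` and satisfies `p ∘ ψ = p`, so it descends to a SECTION `s : A' → M` of `p`: `p ∘ s = id` and `s ∘ p = ψ`.  Any such `s`
  is CANONICAL — it commutes with every pair of endomorphisms `(T, T')` of `(M, A')` that is compatible with `p` and commutes with
  `φ` — and has `range s = ker (φ - b)`, `φ ∘ s = b • s`, `M = ker p ⊕ range s` (`IsCompl`): the extension is the eigen-decomposition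
  `M = ker (φ - a) ⊕ ker (φ - b)` and `p` maps the `b`-eigenspace isomorphically onto `A'`.
* §2 (representations) if `M`, `A'` carry `k`-linear `G`-actions and `p`, `φ` are `G`-equivariant, the section is `G`-equivariant —
  stated in the «`T ∘ₗ ρ g = σ g ∘ₗ T`» currency and packaged as Mathlib `Representation.IntertwiningMap`s
  (`∃ s : IntertwiningMap ρA' ρM, p.comp s = IntertwiningMap.id ρA'`).
* §3 (modules over a `k`-algebra `R`, possibly non-commutative) if `p`, `φ` are `R`-linear the section is `R`-linear (`∃ s : A' →ₗ[R] M`).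
  The SIGN case `a = 1`, `b = -1` (`φ ∘ ι = ι`, `p ∘ φ = -p`, `2` invertible) in this currency is
  `Literature.Algebra.Module.ExtensionSplitting.exists_section_of_sign_endomorphism` (F0P3a-p03, «EXT-SPLIT») and is deliberately
  NOT restated in this file.

This is the standard observation that an extension `0 → A → M → A' → 0` in a `k`-linear abelian category admitting an
endomorphism that acts by DIFFERENT scalars `a ≠ b` (`b - a` invertible) on `A` and on `A'` is split — its class
`e ∈ Ext¹(A', A)` satisfies `(b - a) • e = 0`; equivalently `ψ = ½(1 - φ)` in the sign case factors as `s ∘ p` with `p ∘ s = 1`.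
It is the homological-algebra half of the argument «an intertwining operator acting by opposite signs on the submodule and on the
quotient of a self-extension of a constituent forces that self-extension to split» for reducible unitary principal series; nothing
here is specific to that use.

SOURCES (what is formalised, read at our letters).  Bourbaki, *Algebra II*, Ch. VII §2 no. 1, Prop. 1 with Remarks 2 and 4
(p. VII.6): a module `M` over a ring with a finite direct decomposition `A ≅ ∏ A ⧸ 𝔟ᵢ` is the direct sum of the `Mᵢ = {m | 𝔟ᵢ m = 0}`,
the projectors being the HOMOTHETIES by the central idempotents `eᵢ` (hence commuting with every `A`-linear map) — read at
`A = k[X] ⧸ ((X - a)(X - b)) ≅ k[X]⧸(X - a) × k[X]⧸(X - b)` (`b - a` a unit; `M` an `A`-module through `X ↦ φ`, Ch. VII §5 no. 1),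
whose idempotent `e_b = (X - a)⧸(b - a)` is our `ψ = s ∘ p` and whose components are `ker (φ - a) = ker p` and `ker (φ - b) = range s`;
and Bourbaki, *Algebra I*, Ch. II §1 no. 9, Prop. 15 with Cor. 1 (split exact sequences: a surjective `u` has a linear right inverse
`v` iff `ker u` is a direct factor, and then `Im v` is a supplement of `Ker u`).  Deliberately NOT here: any `Ext`-group language (Mathlib's `Ext` for module categories is not needed
by consumers, who work with explicit surjections and sections), and the analytic input producing such a `φ`.
-/

set_option autoImplicit false

namespace Literature.RepresentationTheory

open Function

/-! ## §1 Linear algebra: the section cut out by an endomorphism with two eigenvalues -/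

section LinearAlgebra

variable {k : Type*} [CommRing k] {M A' : Type*} [AddCommGroup M] [Module k M] [AddCommGroup A'] [Module k A']

/-- If `φ = a` on `ker p` and `p ∘ φ = b • p`, then `(φ - a) ∘ (φ - b) = 0` on `M`: `(φ - b) m ∈ ker p` because
`p (φ m - b m) = b p m - b p m = 0`, and `φ - a` kills `ker p`. [cite: BourbakiAlgebraII2003, Ch. VII §2 no. 1 Prop. 1 and Remarks 2, 4 (p. VII.6)] -/
theorem sub_smul_id_comp_sub_smul_id_eq_zero (p : M →ₗ[k] A') (φ : M →ₗ[k] M) {a b : k}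
    (hker : ∀ m, p m = 0 → φ m = a • m) (hquot : ∀ m, p (φ m) = b • p m) :
    (φ - a • LinearMap.id) ∘ₗ (φ - b • LinearMap.id) = 0 := by
  ext m
  have h1 : p (φ m - b • m) = 0 := by rw [map_sub, map_smul, hquot, sub_self]
  have h2 : φ (φ m - b • m) = a • (φ m - b • m) := hker _ h1
  simp only [LinearMap.comp_apply, LinearMap.sub_apply, LinearMap.smul_apply, LinearMap.id_apply,
    LinearMap.zero_apply, h2, sub_self]

/-- If `φ = a` on `ker p`, `p ∘ φ = b • p` and `b - a` is a unit, then `ker (φ - a) = ker p`: for `φ m = a m` one gets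
`b p m = p (φ m) = a p m`, so `(b - a) p m = 0` and `p m = 0`. [cite: BourbakiAlgebraII2003, Ch. VII §2 no. 1 Prop. 1 and Remarks 2, 4 (p. VII.6)] -/
theorem ker_sub_smul_id_eq_ker (p : M →ₗ[k] A') (φ : M →ₗ[k] M) {a b : k} (hab : IsUnit (b - a))
    (hker : ∀ m, p m = 0 → φ m = a • m) (hquot : ∀ m, p (φ m) = b • p m) :
    LinearMap.ker (φ - a • LinearMap.id) = LinearMap.ker p := by
  ext m
  simp only [LinearMap.mem_ker, LinearMap.sub_apply, LinearMap.smul_apply, LinearMap.id_apply, sub_eq_zero]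
  refine ⟨fun h => ?_, fun h => hker m h⟩
  have h' : (b - a) • p m = 0 := by rw [sub_smul, ← hquot, h, map_smul, sub_self]
  exact (hab.smul_left_cancel).1 (by rw [h', smul_zero])

/-- **THE SECTION** (existence).  For a surjective `p : M → A'` and `φ ∈ End(M)` with `φ = a` on `ker p`, `p ∘ φ = b • p` and
`b - a` a unit, the endomorphism `ψ := (b - a)⁻¹ • (φ - a)` descends through `p`: there is a `k`-linear `s : A' → M` with
`p ∘ s = id` and `s ∘ p = (b - a)⁻¹ • (φ - a • id)`.  (In the sign case `a = 1`, `b = -1` this is `ψ = ½ (1 - φ) = s ∘ p`,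
`p ∘ s = 1`.) [cite: BourbakiAlgebraII2003, Ch. VII §2 no. 1 Prop. 1 and Remarks 2, 4 (p. VII.6)] [cite: BourbakiAlgebre1a3, Ch. II §1 no. 9 Prop. 15 and Cor. 1] -/
theorem exists_section_comp_eq_of_endo_eigen (p : M →ₗ[k] A') (hp : Surjective p) (φ : M →ₗ[k] M) {a b : k}
    (hab : IsUnit (b - a)) (hker : ∀ m, p m = 0 → φ m = a • m) (hquot : ∀ m, p (φ m) = b • p m) :
    ∃ s : A' →ₗ[k] M, p ∘ₗ s = LinearMap.id ∧ s ∘ₗ p = ((hab.unit⁻¹ : kˣ) : k) • (φ - a • LinearMap.id) := by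
  set ψ : M →ₗ[k] M := ((hab.unit⁻¹ : kˣ) : k) • (φ - a • LinearMap.id) with hψ
  have hψ_apply : ∀ m, ψ m = ((hab.unit⁻¹ : kˣ) : k) • (φ m - a • m) := fun m => rfl
  have hψker : LinearMap.ker p ≤ LinearMap.ker ψ := by
    intro m hm
    rw [LinearMap.mem_ker] at hm ⊢
    rw [hψ_apply, hker m hm, sub_self, smul_zero]
  have hpψ : ∀ m, p (ψ m) = p m := by
    intro m
    rw [hψ_apply, map_smul, map_sub, map_smul, hquot, ← sub_smul, smul_smul, IsUnit.val_inv_mul, one_smul]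
  refine ⟨(LinearMap.ker p).liftQ ψ hψker ∘ₗ (p.quotKerEquivOfSurjective hp).symm.toLinearMap, ?_, ?_⟩
  · apply LinearMap.ext
    intro x
    obtain ⟨m, rfl⟩ := hp x
    simp only [LinearMap.comp_apply, LinearEquiv.coe_toLinearMap, LinearMap.quotKerEquivOfSurjective_symm_apply,
      Submodule.liftQ_apply, LinearMap.id_apply, hpψ]
  · apply LinearMap.ext
    intro m
    simp only [LinearMap.comp_apply, LinearEquiv.coe_toLinearMap, LinearMap.quotKerEquivOfSurjective_symm_apply,
      Submodule.liftQ_apply]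

/-- Any section obtained this way is a genuine section: `s ∘ p = (b - a)⁻¹ • (φ - a)` together with `p ∘ φ = b • p` and the
surjectivity of `p` gives `p ∘ s = id` (`p ∘ s ∘ p = p ∘ ψ = p`). [cite: BourbakiAlgebre1a3, Ch. II §1 no. 9 Prop. 15 and Cor. 1] -/
theorem comp_section_eq_id_of_section_comp_eq (p : M →ₗ[k] A') (hp : Surjective p) (φ : M →ₗ[k] M) {a b : k}
    (hab : IsUnit (b - a)) (hquot : ∀ m, p (φ m) = b • p m)
    {s : A' →ₗ[k] M} (hs : s ∘ₗ p = ((hab.unit⁻¹ : kˣ) : k) • (φ - a • LinearMap.id)) :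
    p ∘ₗ s = LinearMap.id := by
  rw [← LinearMap.cancel_right hp, LinearMap.comp_assoc, hs, LinearMap.id_comp]
  ext m
  simp only [LinearMap.comp_apply, LinearMap.smul_apply, LinearMap.sub_apply, LinearMap.id_apply, map_smul, map_sub,
    hquot]
  rw [← sub_smul, smul_smul, IsUnit.val_inv_mul, one_smul]

/-- **CANONICITY ∕ NATURALITY of the section.**  If `s ∘ p = (b - a)⁻¹ • (φ - a)` and `(T, T')` is a pair of endomorphisms of
`(M, A')` compatible with `p` (`p ∘ T = T' ∘ p`) such that `T` commutes with `φ`, then `s ∘ T' = T ∘ s`.  (Both sides agree after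
composing with the surjection `p`.) [cite: BourbakiAlgebraII2003, Ch. VII §2 no. 1 Prop. 1 and Remarks 2, 4 (p. VII.6)] -/
theorem section_comp_eq_comp_section (p : M →ₗ[k] A') (hp : Surjective p) (φ : M →ₗ[k] M) {a b : k}
    (hab : IsUnit (b - a)) {s : A' →ₗ[k] M} (hs : s ∘ₗ p = ((hab.unit⁻¹ : kˣ) : k) • (φ - a • LinearMap.id))
    (T : M →ₗ[k] M) (T' : A' →ₗ[k] A') (hT : p ∘ₗ T = T' ∘ₗ p) (hTφ : T ∘ₗ φ = φ ∘ₗ T) :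
    s ∘ₗ T' = T ∘ₗ s := by
  rw [← LinearMap.cancel_right hp, LinearMap.comp_assoc, ← hT, ← LinearMap.comp_assoc, hs, LinearMap.comp_assoc, hs]
  ext m
  have h := congrArg (fun f : M →ₗ[k] M => f m) hTφ
  simp only [LinearMap.comp_apply] at h
  simp only [LinearMap.comp_apply, LinearMap.smul_apply, LinearMap.sub_apply, LinearMap.id_apply, map_smul, map_sub, h]

/-- `φ` acts by the scalar `b` on the image of the section: `φ ∘ s = b • s` (from `(φ - a)(φ - b) = 0`, read as
`φ (φ - a) = b (φ - a)`). [cite: BourbakiAlgebraII2003, Ch. VII §2 no. 1 Prop. 1 and Remarks 2, 4 (p. VII.6)] -/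
theorem endo_comp_section_eq_smul (p : M →ₗ[k] A') (hp : Surjective p) (φ : M →ₗ[k] M) {a b : k}
    (hab : IsUnit (b - a)) (hker : ∀ m, p m = 0 → φ m = a • m) (hquot : ∀ m, p (φ m) = b • p m)
    {s : A' →ₗ[k] M} (hs : s ∘ₗ p = ((hab.unit⁻¹ : kˣ) : k) • (φ - a • LinearMap.id)) :
    φ ∘ₗ s = b • s := by
  rw [← LinearMap.cancel_right hp, LinearMap.comp_assoc, hs, LinearMap.smul_comp, hs]
  ext m
  have h0 := congrArg (fun f : M →ₗ[k] M => f m) (sub_smul_id_comp_sub_smul_id_eq_zero p φ hker hquot)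
  simp only [LinearMap.comp_apply, LinearMap.sub_apply, LinearMap.smul_apply, LinearMap.id_apply,
    LinearMap.zero_apply, map_sub, map_smul] at h0
  simp only [LinearMap.comp_apply, LinearMap.smul_apply, LinearMap.sub_apply, LinearMap.id_apply, map_smul, map_sub]
  -- `h0 : φ (φ m) - a φ m = b (φ m - a m)`
  rw [sub_eq_zero] at h0
  rw [h0]
  exact smul_comm _ _ _

/-- The image of the section is the `b`-eigenspace: `range s = ker (φ - b)`. [cite: BourbakiAlgebraII2003, Ch. VII §2 no. 1 Prop. 1 and Remarks 2, 4 (p. VII.6)] -/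
theorem range_section_eq_ker_sub_smul_id (p : M →ₗ[k] A') (hp : Surjective p) (φ : M →ₗ[k] M) {a b : k}
    (hab : IsUnit (b - a)) (hker : ∀ m, p m = 0 → φ m = a • m) (hquot : ∀ m, p (φ m) = b • p m)
    {s : A' →ₗ[k] M} (hs : s ∘ₗ p = ((hab.unit⁻¹ : kˣ) : k) • (φ - a • LinearMap.id)) :
    LinearMap.range s = LinearMap.ker (φ - b • LinearMap.id) := by
  have hφs := endo_comp_section_eq_smul p hp φ hab hker hquot hs
  ext m
  simp only [LinearMap.mem_range, LinearMap.mem_ker, LinearMap.sub_apply, LinearMap.smul_apply, LinearMap.id_apply,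
    sub_eq_zero]
  constructor
  · rintro ⟨x, rfl⟩
    have h := congrArg (fun f : A' →ₗ[k] M => f x) hφs
    simpa only [LinearMap.comp_apply, LinearMap.smul_apply] using h
  · intro hm
    refine ⟨p m, ?_⟩
    have h := congrArg (fun f : M →ₗ[k] M => f m) hs
    simp only [LinearMap.comp_apply, LinearMap.smul_apply, LinearMap.sub_apply, LinearMap.id_apply] at h
    rw [h, hm, ← sub_smul, smul_smul, IsUnit.val_inv_mul, one_smul]

/-- **THE EXTENSION SPLITS**: `M = ker p ⊕ range s` for the section `s` (`IsCompl (ker p) (range s)`). [cite: BourbakiAlgebre1a3, Ch. II §1 no. 9 Prop. 15 and Cor. 1] -/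
theorem isCompl_ker_range_section (p : M →ₗ[k] A') {s : A' →ₗ[k] M} (hps : p ∘ₗ s = LinearMap.id) :
    IsCompl (LinearMap.ker p) (LinearMap.range s) := by
  have hps' : ∀ y, p (s y) = y := fun y => by
    have h := congrArg (fun f : A' →ₗ[k] A' => f y) hps
    simpa only [LinearMap.comp_apply, LinearMap.id_apply] using h
  refine IsCompl.of_eq ?_ ?_
  · rw [Submodule.eq_bot_iff]
    rintro m ⟨hm, ⟨y, rfl⟩⟩
    rw [SetLike.mem_coe, LinearMap.mem_ker, hps'] at hm
    rw [hm, map_zero]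
  · rw [Submodule.eq_top_iff']
    intro m
    rw [Submodule.mem_sup]
    refine ⟨m - s (p m), ?_, s (p m), ⟨p m, rfl⟩, sub_add_cancel _ _⟩
    rw [LinearMap.mem_ker, map_sub, hps', sub_self]

end LinearAlgebra

/-! ## §2 Representations: the section is equivariant -/

section Representations

open Representation

variable {k : Type*} [CommRing k] {G : Type*} [Monoid G]
  {A M A' : Type*} [AddCommGroup A] [Module k A] [AddCommGroup M] [Module k M] [AddCommGroup A'] [Module k A']

/-- **EQUIVARIANT SECTION** (tree currency `T ∘ₗ ρ g = σ g ∘ₗ T`).  Let `ρM`, `ρA'` be `k`-linear representations of a monoid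
`G` on `M`, `A'`, `p : M → A'` a SURJECTIVE equivariant `k`-linear map and `φ` an equivariant endomorphism of `M` acting as the
scalar `a` on `ker p` and inducing the scalar `b` on `A'` (`p ∘ φ = b • p`), with `b - a` a unit of `k`.  Then `p` has an
EQUIVARIANT `k`-linear section `s` (`p ∘ s = id`, `s ∘ ρA' g = ρM g ∘ s` for all `g`), namely the descent of
`(b - a)⁻¹ • (φ - a)`; so the extension `0 → ker p → M → A' → 0` of `G`-representations splits. [cite: BourbakiAlgebraII2003, Ch. VII §2 no. 1 Prop. 1 and Remarks 2, 4 (p. VII.6)] [cite: BourbakiAlgebre1a3, Ch. II §1 no. 9 Prop. 15 and Cor. 1] -/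
theorem exists_equivariant_section_of_endo_eigen (ρM : Representation k G M) (ρA' : Representation k G A')
    (p : M →ₗ[k] A') (hp : Surjective p) (hpG : ∀ g : G, p ∘ₗ ρM g = ρA' g ∘ₗ p)
    (φ : M →ₗ[k] M) (hφG : ∀ g : G, φ ∘ₗ ρM g = ρM g ∘ₗ φ) {a b : k} (hab : IsUnit (b - a))
    (hker : ∀ m, p m = 0 → φ m = a • m) (hquot : ∀ m, p (φ m) = b • p m) :
    ∃ s : A' →ₗ[k] M, p ∘ₗ s = LinearMap.id ∧
      s ∘ₗ p = ((hab.unit⁻¹ : kˣ) : k) • (φ - a • LinearMap.id) ∧ ∀ g : G, s ∘ₗ ρA' g = ρM g ∘ₗ s := by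
  obtain ⟨s, hps, hsp⟩ := exists_section_comp_eq_of_endo_eigen p hp φ hab hker hquot
  exact ⟨s, hps, hsp, fun g =>
    section_comp_eq_comp_section p hp φ hab hsp (ρM g) (ρA' g) (hpG g) (hφG g).symm⟩

/-- **EQUIVARIANT SECTION, `IntertwiningMap` packaging.**  For Mathlib intertwining maps `p : M →ᴳ A'` (surjective) and
`φ : M →ᴳ M` with `φ = a` on `ker p`, `p ∘ φ = b • p` and `b - a` a unit: there is an intertwining map `s : A' →ᴳ M` with
`p.comp s = IntertwiningMap.id ρA'` and underlying linear map the descent of `(b - a)⁻¹ • (φ - a)`. [cite: BourbakiAlgebraII2003, Ch. VII §2 no. 1 Prop. 1 and Remarks 2, 4 (p. VII.6)] [cite: BourbakiAlgebre1a3, Ch. II §1 no. 9 Prop. 15 and Cor. 1] -/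
theorem exists_intertwiningMap_comp_eq_id_of_endo_eigen {ρM : Representation k G M} {ρA' : Representation k G A'}
    (p : IntertwiningMap ρM ρA') (hp : Surjective p) (φ : IntertwiningMap ρM ρM) {a b : k} (hab : IsUnit (b - a))
    (hker : ∀ m, p m = 0 → φ m = a • m) (hquot : ∀ m, p (φ m) = b • p m) :
    ∃ s : IntertwiningMap ρA' ρM, p.comp s = IntertwiningMap.id ρA' ∧
      s.toLinearMap ∘ₗ p.toLinearMap = ((hab.unit⁻¹ : kˣ) : k) • (φ.toLinearMap - a • LinearMap.id) := by
  obtain ⟨s, hps, hsp, hsG⟩ := exists_equivariant_section_of_endo_eigen ρM ρA' p.toLinearMap hp p.isIntertwining'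
    φ.toLinearMap φ.isIntertwining' hab hker hquot
  refine ⟨⟨s, hsG⟩, IntertwiningMap.ext ?_, hsp⟩
  rw [IntertwiningMap.comp_toLinearMap, IntertwiningMap.toLinearMap_id]
  exact hps

end Representations

/-! ## §3 Modules over a `k`-algebra: the section is `R`-linear -/

section Algebra

variable {k : Type*} [CommRing k] {R : Type*} [Ring R] [Algebra k R]
  {M A' : Type*} [AddCommGroup M] [Module R M] [Module k M] [IsScalarTower k R M]
  [AddCommGroup A'] [Module R A'] [Module k A'] [IsScalarTower k R A']

/-- **`R`-LINEAR SECTION** (currency of modules over a possibly non-commutative `k`-algebra `R` — group algebras, Hecke algebras).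
For `R`-linear `p : M → A'` (surjective) and `φ ∈ End_R(M)` with `φ = a` on `ker p`, `p ∘ φ = b • p` (`a b : k`, `b - a` a unit of `k`),
the section of §1 is `R`-linear: `∃ s : A' →ₗ[R] M`, `p ∘ s = id`, `s ∘ p = (b - a)⁻¹ • (φ - a)` (as `k`-linear maps).  Proof: the
`k`-linear section is canonical (§1 `section_comp_eq_comp_section`), so it commutes with every homothety `m ↦ r • m`, `r ∈ R`.  The
sign case `a = 1`, `b = -1` (`2` invertible) of this statement is F0P3a-p03's `Literature.Algebra.Module.ExtensionSplitting.
exists_section_of_sign_endomorphism` («EXT-SPLIT»), which is therefore NOT restated here.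
[cite: BourbakiAlgebraII2003, Ch. VII §2 no. 1 Prop. 1 and Remarks 2, 4 (p. VII.6)] [cite: BourbakiAlgebre1a3, Ch. II §1 no. 9 Prop. 15 and Cor. 1] -/
theorem exists_section_restrictScalars_comp_eq_of_endo_eigen (p : M →ₗ[R] A') (hp : Surjective p) (φ : M →ₗ[R] M)
    {a b : k} (hab : IsUnit (b - a)) (hker : ∀ m, p m = 0 → φ m = a • m) (hquot : ∀ m, p (φ m) = b • p m) :
    ∃ s : A' →ₗ[R] M, p ∘ₗ s = LinearMap.id ∧
      s.restrictScalars k ∘ₗ p.restrictScalars k =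
        ((hab.unit⁻¹ : kˣ) : k) • (φ.restrictScalars k - a • LinearMap.id) := by
  obtain ⟨s, hps, hsp⟩ :=
    exists_section_comp_eq_of_endo_eigen (p.restrictScalars k) hp (φ.restrictScalars k) hab hker hquot
  -- `s` commutes with the homotheties `r • ·` (canonicity), hence is `R`-linear
  have hsr : ∀ r : R, ∀ x : A', s (r • x) = r • s x := by
    intro r x
    have hT : p.restrictScalars k ∘ₗ DistribSMul.toLinearMap k M r =
        DistribSMul.toLinearMap k A' r ∘ₗ p.restrictScalars k := by
      ext m
      simp only [LinearMap.comp_apply, DistribSMul.toLinearMap_apply, LinearMap.coe_restrictScalars, LinearMap.map_smul_of_tower]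
    have hTφ : DistribSMul.toLinearMap k M r ∘ₗ φ.restrictScalars k =
        φ.restrictScalars k ∘ₗ DistribSMul.toLinearMap k M r := by
      ext m
      simp only [LinearMap.comp_apply, DistribSMul.toLinearMap_apply, LinearMap.coe_restrictScalars, LinearMap.map_smul_of_tower]
    have h := section_comp_eq_comp_section (p.restrictScalars k) hp (φ.restrictScalars k) hab hsp
      (DistribSMul.toLinearMap k M r) (DistribSMul.toLinearMap k A' r) hT hTφ
    have h' := congrArg (fun f : A' →ₗ[k] M => f x) h
    simpa only [LinearMap.comp_apply, DistribSMul.toLinearMap_apply] using h'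
  let s' : A' →ₗ[R] M := { toFun := s, map_add' := fun x y => map_add s x y, map_smul' := fun r x => hsr r x }
  have hs' : ∀ x, s' x = s x := fun _ => rfl
  refine ⟨s', ?_, ?_⟩
  · apply LinearMap.ext
    intro x
    have h := congrArg (fun f : A' →ₗ[k] A' => f x) hps
    simp only [LinearMap.comp_apply, LinearMap.coe_restrictScalars, LinearMap.id_apply] at h
    rw [LinearMap.comp_apply, hs', LinearMap.id_apply]
    exact h
  · apply LinearMap.ext
    intro m
    have h := congrArg (fun f : M →ₗ[k] M => f m) hsp
    simp only [LinearMap.comp_apply, LinearMap.coe_restrictScalars] at h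
    rw [LinearMap.comp_apply, LinearMap.coe_restrictScalars, LinearMap.coe_restrictScalars, hs']
    exact h

end Algebra

end Literature.RepresentationTheory
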